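import Literature.AlgebraicGeometry.HodgeTheory.AbelianVarietyCyclotomicAutomorphismCyclotomicUnits
import Mathlib.Algebra.Module.ZMod
import Mathlib.Algebra.Field.ZMod
import Mathlib.Algebra.Group.TypeTags.Finite
import Mathlib.FieldTheory.Finiteness
import Mathlib.LinearAlgebra.Dimension.Free
import HarnessLib

/-!
# The `(1 − ζ)`-torsion of a cyclotomic automorphism of prime-power level is elementary abelian:
# `Ker(1_A − δ)(ℂ) ≅ (ℤ/pℤ)^{2g/φ(p^{k+1})}`, `Ker((1 − δ)^j)(ℂ) ≅ (ℤ/pℤ)^{j·2g/φ(p^{k+1})}` for `j ≤ φ(p^{k+1})`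

Family `hodge`, lane `lit-hodgefound` (seat p03, GEN 37 «the cyclotomic order `ℤ[δ]`: norms, degrees, kernels, torsion
and periodic points of the endomorphisms `Q(δ)`»), topic `Literature/AlgebraicGeometry/HodgeTheory`.  Theorems only: no
definition, no instance, no named fact (net Literature debt 0).

Zarhin (cyclic covers of `ℙ¹`): «Let us put `η = 1 − δ_p`. Clearly, `η` divides `p` in `ℤ[δ_p] ≅ ℤ[ζ_p]` […] `J(η)` is
killed by multiplication by `p`, i.e., it may be viewed as a `𝔽_p`-vector space […] `dim_{𝔽_p} J(η) = 2g/(p−1)`».  For an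
endomorphism `δ` of a complex abelian variety `A` of dimension `g` with `Φ_{p^{k+1}}(δ) = 0` GEN 37 rows 3 and 6 give
`Ker(1_A − δ)(ℂ) ⊆ A[p](ℂ)` of order `p^{2g/φ(p^{k+1})}` and `Ker((1 − δ)^j)(ℂ) ⊆ Ker((1 − δ)^{φ(p^{k+1})})(ℂ) = A[p](ℂ)` of
order `p^{j·2g/φ(p^{k+1})}` (`j ≤ φ(p^{k+1})`); a finite abelian group killed by `p` of order `p^d` is `≅ (ℤ/pℤ)^d`
(Mathlib's `ZMod p`-module structure `AddCommGroup.zmodModule`, `Module.natCard_eq_pow_finrank`, a basis).  Hence: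

* **`Ker(1_A − δ)(ℂ) ≃ (ℤ/pℤ)^{2g/φ(p^{k+1})}`** as groups (`nonempty_mulEquiv_kerPoints_one_sub`, additive form
  `nonempty_addEquiv_kerPoints_one_sub`; prime level: `(ℤ/pℤ)^{2g/(p−1)}`, `nonempty_addEquiv_kerPoints_one_sub_prime`).
* **`Ker((1 − δ)^j)(ℂ) ≃ (ℤ/pℤ)^{j·2g/φ(p^{k+1})}` for `j ≤ φ(p^{k+1})`** (`nonempty_addEquiv_kerPoints_one_sub_pow`), the
  monotonicity `Ker((1 − δ)^i) ⊆ Ker((1 − δ)^j)` (`i ≤ j`, any field, `kerPoints_one_sub_pow_mono`) and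
  `Ker((1 − δ)^j)(L) ⊆ A[p](L)` for `j ≤ φ(p^{k+1})` over any field (`kerPoints_one_sub_pow_le_torsionPoints_prime_of_le`).

## Sources, verbatim (held texts)

Yu. G. Zarhin, *Cyclic covers of the projective line, their jacobians and endomorphisms* (J. reine angew. Math. 544
(2002); arXiv:math/0008134), held `paper:arxiv-math_0008134`, §3 after Remarks 3.2 (chunk p0006 L138–L152): «Let us put
`η = 1 − δ_p`. Clearly, `η` divides `p` in `ℤ[δ_p] ≅ ℤ[ζ_p]`, i.e., there exists `η′ ∈ ℤ[δ_p]` such that `ηη′ = η′η = p`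
[…] Let `J^{(f,p)}(η)` be the kernel of `η` in `J^{(f,p)}(K_a)`. Clearly, `J^{(f,p)}(η)` is killed by multiplication by
`p`, i.e., it may be viewed as a `𝔽_p`-vector space. It follows from Ribet's theorem that `dim_{𝔽_p} J^{(f,p)}(η) = 2g/(p−1)`».

Yu. G. Zarhin, *Jacobians with automorphisms of prime order*, arXiv:2109.06794, held `paper:arxiv-2109.06794`, §1 (chunk
p0003 L16–L23).

D. Mumford, *Abelian Varieties* (1970), §6 Application 3 (p. 64): `A[n] ≅ (ℤ/nℤ)^{2g}`.

## References

* [Zarhin2002CyclicCovers] Yu. G. Zarhin, J. reine angew. Math. 544 (2002), §3 (chunk p0006 L138–L152).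
* [Zarhin2021PrimeOrderJacobians] Yu. G. Zarhin, arXiv:2109.06794, §1 (chunk p0003).
* [MumfordAV1970] D. Mumford, *Abelian Varieties* (1970), §6 Application 3 (p. 64).
* [FrohlichTaylor1990] A. Fröhlich, M. J. Taylor, *Algebraic Number Theory*, VI §1 Thm. 45 (PDF p. 190).
-/

noncomputable section

open CategoryTheory Module Polynomial

universe u

namespace Literature.AlgebraicGeometry.HodgeTheory

namespace AbelianVariety

open Literature.AlgebraicGeometry.Motives Literature.AlgebraicGeometry.Motives.AbelianVariety

/-! ## §0 Finite abelian groups of prime exponent -/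

section Group

/-- A finite commutative group of exponent `p` (prime) and order `p^d` is `≅ (ℤ/pℤ)^d` (it is a `𝔽_p`-vector space of
dimension `d`). [folklore] -/
private theorem nonempty_addEquiv_of_pow_prime_eq_one₃₇ {G : Type*} [CommGroup G] [Finite G] {p : ℕ} [hp : Fact p.Prime]
    {d : ℕ} (hexp : ∀ g : G, g ^ p = 1) (hcard : Nat.card G = p ^ d) : Nonempty (Additive G ≃+ (Fin d → ZMod p)) := by
  letI inst : Module (ZMod p) (Additive G) := AddCommGroup.zmodModule (fun x ↦ by
    rw [← ofMul_toMul x, ← ofMul_pow, hexp, ofMul_one])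
  haveI : Finite (Additive G) := inferInstanceAs (Finite G)
  haveI instF : Module.Finite (ZMod p) (Additive G) := Module.Finite.of_finite
  haveI instFr : Module.Free (ZMod p) (Additive G) := Module.Free.of_divisionRing _ _
  have h := @Module.natCard_eq_pow_finrank (ZMod p) (Additive G) _ _ inst instF
  have hrank : finrank (ZMod p) (Additive G) = d := by
    rw [Nat.card_zmod, show Nat.card (Additive G) = Nat.card G from rfl, hcard] at h
    exact (Nat.pow_right_injective hp.out.two_le h).symm
  exact ⟨(@Module.finBasisOfFinrankEq (ZMod p) (Additive G) _ _ inst instFr _ instF d hrank).equivFun.toAddEquiv⟩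

/-- Multiplicative form. [folklore] -/
private theorem nonempty_mulEquiv_of_pow_prime_eq_one₃₇ {G : Type*} [CommGroup G] [Finite G] {p : ℕ} [hp : Fact p.Prime]
    {d : ℕ} (hexp : ∀ g : G, g ^ p = 1) (hcard : Nat.card G = p ^ d) :
    Nonempty (G ≃* Multiplicative (Fin d → ZMod p)) := by
  obtain ⟨e⟩ := nonempty_addEquiv_of_pow_prime_eq_one₃₇ hexp hcard
  exact ⟨(MulEquiv.refl G).trans (AddEquiv.toMultiplicativeRight e)⟩

end Group

/-! ## §1 Monotonicity and `p`-torsion bounds over any field -/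

section AnyField

variable {k : Type u} [Field k] {A : Motives.AbelianVariety k} {δ : A ⟶ A}
  {L : Type u} [Field L] [Algebra k L]

/-- **`Ker((1 − δ)^i)(L) ⊆ Ker((1 − δ)^j)(L)` for `i ≤ j`.** [cite: Zarhin2002CyclicCovers, §3 (chunk p0006 L138–L152)] -/
theorem kerPoints_one_sub_pow_mono (δ : A ⟶ A) {i j : ℕ} (hij : i ≤ j) :
    Hom.kerPoints (specOver k L) (End.asHom ((1 - End.of δ) ^ i)) ≤
      Hom.kerPoints (specOver k L) (End.asHom ((1 - End.of δ) ^ j)) := by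
  obtain ⟨d, rfl⟩ := Nat.exists_eq_add_of_le hij
  have h : End.asHom ((1 - End.of δ) ^ (i + d)) = End.asHom ((1 - End.of δ) ^ i) ≫ End.asHom ((1 - End.of δ) ^ d) := by
    rw [add_comm, pow_add, End.mul_def]
  rw [h]
  exact Hom.kerPoints_le_kerPoints_comp _ _

variable {p : ℕ} [hp : Fact p.Prime]

/-- **`Ker((1 − δ)^j)(L) ⊆ A[p](L)` for `j ≤ φ(p^{k+1})`** (`Φ_{p^{k+1}}(δ) = 0`, any field): «`η` divides `p` in `ℤ[δ_p]` […]
`J(η)` is killed by multiplication by `p`» and `Ker((1 − δ)^{φ}) = A[p]` (GEN 37 row 6).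
[cite: Zarhin2002CyclicCovers, §3 (chunk p0006 L138–L152)] [cite: FrohlichTaylor1990, VI §1 Thm. 45 (a) (PDF p. 190)] -/
theorem kerPoints_one_sub_pow_le_torsionPoints_prime_of_le {n : ℕ}
    (hδ : (cyclotomic (p ^ (n + 1)) ℤ).eval₂ (Int.castRingHom (End A)) (End.of δ) = 0) {j : ℕ}
    (hj : j ≤ Nat.totient (p ^ (n + 1))) :
    Hom.kerPoints (specOver k L) (End.asHom ((1 - End.of δ) ^ j)) ≤ A.torsionPoints L p := by
  rw [← kerPoints_one_sub_pow_totient_eq_torsionPoints_prime_pow hδ]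
  exact kerPoints_one_sub_pow_mono δ hj

end AnyField

/-! ## §2 Over `ℂ`: the kernels are `𝔽_p`-vector spaces of the predicted dimension -/

section Complex

variable {A : Motives.AbelianVariety ℂ} {δ : A ⟶ A} {p : ℕ} [hp : Fact p.Prime]

/-- **`Ker(1_A − δ)(ℂ) ≃ (ℤ/pℤ)^{2g/φ(p^{k+1})}`** for `Φ_{p^{k+1}}(δ) = 0`: the fixed points of `δ` form an `𝔽_p`-vector space of
dimension `2g/φ(p^{k+1})` («`dim_{𝔽_p} J(η) = 2g/(p−1)`», `η = 1 − δ_p`) — additive form.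
[cite: Zarhin2002CyclicCovers, §3 (chunk p0006 L138–L152)] [cite: MumfordAV1970, §6 Application 3 (p. 64)] -/
theorem nonempty_addEquiv_kerPoints_one_sub {n : ℕ}
    (hδ : (cyclotomic (p ^ (n + 1)) ℤ).eval₂ (Int.castRingHom (End A)) (End.of δ) = 0) :
    Nonempty (Additive (Hom.kerPoints (specOver ℂ ℂ) (𝟙 A - δ)) ≃+ (Fin (2 * A.dim / Nat.totient (p ^ (n + 1))) → ZMod p)) := by
  have hcard := natCard_kerPoints_one_sub_eq_prime_pow hδ
  haveI : Finite (Hom.kerPoints (specOver ℂ ℂ) (𝟙 A - δ)) :=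
    Nat.finite_of_card_ne_zero (by rw [hcard]; exact pow_ne_zero _ hp.out.ne_zero)
  refine nonempty_addEquiv_of_pow_prime_eq_one₃₇ (fun g ↦ ?_) hcard
  have hg := kerPoints_one_sub_le_torsionPoints_prime (L := ℂ) hδ g.2
  rw [mem_torsionPoints_iff, zpow_natCast] at hg
  exact Subtype.ext (by rw [Subgroup.coe_pow, hg, Subgroup.coe_one])

/-- **`Ker(1_A − δ)(ℂ) ≃ (ℤ/pℤ)^{2g/φ(p^{k+1})}`**, multiplicative form (the tree's point groups are written multiplicatively).
[cite: Zarhin2002CyclicCovers, §3 (chunk p0006 L138–L152)] -/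
theorem nonempty_mulEquiv_kerPoints_one_sub {n : ℕ}
    (hδ : (cyclotomic (p ^ (n + 1)) ℤ).eval₂ (Int.castRingHom (End A)) (End.of δ) = 0) :
    Nonempty (Hom.kerPoints (specOver ℂ ℂ) (𝟙 A - δ) ≃* Multiplicative (Fin (2 * A.dim / Nat.totient (p ^ (n + 1))) → ZMod p)) := by
  obtain ⟨e⟩ := nonempty_addEquiv_kerPoints_one_sub hδ
  exact ⟨(MulEquiv.refl _).trans (AddEquiv.toMultiplicativeRight e)⟩

/-- **Prime level: `Ker(1_A − δ)(ℂ) ≃ (ℤ/pℤ)^{2g/(p−1)}`** — «`dim_{𝔽_p} J(η) = 2g/(p−1)`» for any complex abelian variety with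
`Φ_p(δ) = 0`. [cite: Zarhin2002CyclicCovers, §3 (chunk p0006 L138–L152)] [cite: Zarhin2021PrimeOrderJacobians, §1 (chunk p0003 L16–L19)] -/
theorem nonempty_addEquiv_kerPoints_one_sub_prime
    (hδ : (cyclotomic p ℤ).eval₂ (Int.castRingHom (End A)) (End.of δ) = 0) :
    Nonempty (Additive (Hom.kerPoints (specOver ℂ ℂ) (𝟙 A - δ)) ≃+ (Fin (2 * A.dim / (p - 1)) → ZMod p)) := by
  have hδ' : (cyclotomic (p ^ (0 + 1)) ℤ).eval₂ (Int.castRingHom (End A)) (End.of δ) = 0 := by rwa [zero_add, pow_one]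
  have h := nonempty_addEquiv_kerPoints_one_sub hδ'
  rwa [zero_add, pow_one, Nat.totient_prime hp.out] at h

/-- **`Ker((1 − δ)^j)(ℂ) ≃ (ℤ/pℤ)^{j·2g/φ(p^{k+1})}` for `j ≤ φ(p^{k+1})`**: the `η^j`-torsion (`η = 1 − δ`) is an `𝔽_p`-vector
space of dimension `j · 2g/φ(p^{k+1})` (killed by `p` since `η^{φ} ∼ p`; order `p^{j·2g/φ}` by GEN 37 row 6).
[cite: Zarhin2002CyclicCovers, §3 (chunk p0006 L138–L152)] [cite: FrohlichTaylor1990, VI §1 Thm. 45 (a) (PDF p. 190)] -/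
theorem nonempty_addEquiv_kerPoints_one_sub_pow {n : ℕ}
    (hδ : (cyclotomic (p ^ (n + 1)) ℤ).eval₂ (Int.castRingHom (End A)) (End.of δ) = 0) {j : ℕ}
    (hj : j ≤ Nat.totient (p ^ (n + 1))) :
    Nonempty (Additive (Hom.kerPoints (specOver ℂ ℂ) (End.asHom ((1 - End.of δ) ^ j))) ≃+
      (Fin (j * (2 * A.dim / Nat.totient (p ^ (n + 1)))) → ZMod p)) := by
  have hcard := natCard_kerPoints_one_sub_pow_eq_prime_pow hδ j
  haveI : Finite (Hom.kerPoints (specOver ℂ ℂ) (End.asHom ((1 - End.of δ) ^ j))) :=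
    Nat.finite_of_card_ne_zero (by rw [hcard]; exact pow_ne_zero _ hp.out.ne_zero)
  refine nonempty_addEquiv_of_pow_prime_eq_one₃₇ (fun g ↦ ?_) hcard
  have hg := kerPoints_one_sub_pow_le_torsionPoints_prime_of_le (L := ℂ) hδ hj g.2
  rw [mem_torsionPoints_iff, zpow_natCast] at hg
  exact Subtype.ext (by rw [Subgroup.coe_pow, hg, Subgroup.coe_one])

/-- **`A[p](ℂ) = Ker((1 − δ)^{φ(p^{k+1})})(ℂ) ≃ (ℤ/pℤ)^{2g}`** read through the `η`-adic filtration (`j = φ`: `φ · 2g/φ = 2g`).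
[cite: MumfordAV1970, §6 Application 3 (p. 64)] [cite: Zarhin2002CyclicCovers, §3 (chunk p0006 L138–L152)] -/
theorem nonempty_addEquiv_kerPoints_one_sub_pow_totient {n : ℕ}
    (hδ : (cyclotomic (p ^ (n + 1)) ℤ).eval₂ (Int.castRingHom (End A)) (End.of δ) = 0) :
    Nonempty (Additive (Hom.kerPoints (specOver ℂ ℂ) (End.asHom ((1 - End.of δ) ^ Nat.totient (p ^ (n + 1))))) ≃+
      (Fin (2 * A.dim) → ZMod p)) := by
  have h := nonempty_addEquiv_kerPoints_one_sub_pow hδ le_rfl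
  rwa [Nat.mul_div_cancel' (totient_dvd_two_mul_dim (pow_pos hp.out.pos _) hδ)] at h

end Complex

end AbelianVariety

end Literature.AlgebraicGeometry.HodgeTheory
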